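/-
Copyright (c) 2026 the pub-hodgecm-mathlib formalisation cell (harness21).  Prover seat hodgecm-mathlib-K2E4-p01 (g3), Track B «K2-LIT» ∕ h413
(stmt-HodgeConjecture-24833), socket #22S road, F-B re-cut (RK2_v): (T⁺) the TRANSPORT of the shell kit (GS^P⁺) to the H-side at a split place.  2026-09-04.
-/
import Summits.HodgeConjecture.HodgeConjecture.Theorems.K2E3CentralGermStructureSplitOfGSP     -- ★ p856204 (K2E4-p07 (g3)): the one-point transport `stableOrbitalIntegralRel_comp_eq_of_forall_canonical`, the frame
import Summits.HodgeConjecture.HodgeConjecture.Theorems.K2E3GLTwoCentralGermShellKit           -- ★ (this seat): (GS^P⁺), the `P`-side shell kit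
import HarnessLib

/-!
# h413 ∕ Track B «K2-LIT» — (GS_v⁺ ∣ w): the H-side central germ structure AT A SPLIT PLACE together with the SHELL KIT, read through the frame
# `j_w = (cmSplitEquivTwo, cmSplitEquivOne)` of a chosen place `w ∣ v` of `L`

Cell `pub/hodgecm-mathlib`, crux H413 = `stmt-HodgeConjecture-24833` (supports-only).  Socket #22S = ★ p855314 `weakMatrixFiniteTransport_of_germStructure` modulo
`hGS` + `hRK`; the rank-two pairs `hRK` are built at the frame level (next file `K2E4SplitTransferRankTwo`) from the named split transfer ★ `cmSplitTransfer`, which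
lives in the frame `j_w`.  THIS FILE transports ★ `K2E3GLTwoCentralGermShellKit.exists_ellipticRay_orbitalIntegral_eq_add_mul_shellKit` along `j_w`
(clone of ★ p856204 §2, K2E4-p07 (g3), whose one-point lemma `stableOrbitalIntegralRel_comp_eq_of_forall_canonical` is imported): for the canonical family `mHv` and a
Haar `νHv` on `H_v`, a ray `γ_n → (γ_H)_v` of `G`-regular elements, `G`, `λ ≠ 0`, `λ′` with the (GS) germ∕central-value clause, AND a sequence `y_n ~ γ_n` with
`y_n → Y`, `j_w(Y) = ((e₁ 0; e₁ e₁), (γ_H)_{v,2})`, and the criterion «`φ` smooth, phase-coherent on the classes of `γ_n`, charging `k y_n k⁻¹` for `j_w(k) ∈ K_P`,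
`n ≥ N` ⇒ `Φ^st_H(γ_n, φ) ≠ 0` for `n ≫ 0`».  **`centralGermShellKit_split`** (place `w` and `hw` are ARGUMENTS: the kit is frame-dependent by design).

HONEST LABEL: HC_CM is proved only modulo the 7 printed citations (2 remaining named inputs: hLiu418 = `stmt-HodgeConjecture-24832`,
h413 = `stmt-HodgeConjecture-24833`) until rung 0 closes; this file is an unconditional local theorem and moves no counter by itself.

## References
* [Rogawski1990] J. D. Rogawski, *Automorphic Representations of Unitary Groups in Three Variables* (1990), §8.1 Props. 8.1.1–8.1.3 pp. 114–116; §4.3 (4.3.1) p. 43; §14.2 p. 232.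
* [HarishChandra1999AdmissibleDistributions] Harish-Chandra (DeBacker–Sally), *Admissible Invariant Distributions on Reductive p-adic Groups* (1999), Thm. 3.1.
* [LabesseLanglands1979] J.-P. Labesse, R. P. Langlands, *L-indistinguishability for SL(2)*, Canad. J. Math. 31 (1979), §2 pp. 7–9.
-/

set_option autoImplicit false
set_option linter.dupNamespace false

noncomputable section

open MeasureTheory Measure NumberField IsDedekindDomain Matrix Polynomial Filter
open Literature.MeasureTheory.Group
open Literature.NumberTheory.Rogawski1990 Literature.NumberTheory.Automorphic Literature.NumberTheory.GaloisRepresentations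
open Literature.AlgebraicGeometry.ShimuraVarieties (unitaryGroup hermForm)
open Summit.HodgeConjecture.HodgeConjecture.Cruxes.H413.K2E3CentralGermStructureSplitOfGSP (stableOrbitalIntegralRel_comp_eq_of_forall_canonical)
open scoped MatrixGroups Topology

namespace Summit.HodgeConjecture.HodgeConjecture.Cruxes.H413.K2E3CentralGermShellKitSplit

set_option maxHeartbeats 1600000 in
set_option synthInstance.maxHeartbeats 400000 in
/-- **(T⁺) THE SHELL KIT AT A SPLIT PLACE, in the frame `j_w`.**  Hypothesis = (GS^P⁺) for every non-archimedean local field `F : Type` (★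
`K2E3GLTwoCentralGermShellKit.exists_ellipticRay_orbitalIntegral_eq_add_mul_shellKit` verbatim, `∀`-closed); conclusion = for a place `v` of `L⁺`, a place `w ∣ v` of `L`
with `c̄w ≠ w` (split), a Haar `νHv` and a canonical family `mHv` on `H_v`, and `γ_H = (e₁·1₂, γ_H.2)`: a `G`-regular ray `γ_n → (γ_H)_v`, `G` with infinite range,
`λ ≠ 0`, `λ′`, the (GS) clause `Φ^st_H(γ_n, φ) = a + b·G_n ∧ φ((γ_H)_v) = λa + λ′b`, and the kit: `y_n ~ γ_n`, `y_n → Y` with `cmSplitEquivTwo Y.1 = (e₁ 0; e₁ e₁)`,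
`cmSplitEquivOne Y.2 = cmSplitEquivOne (γ_H)_{v,2}`, and the coherent-positivity criterion (charging tested on `k` with `j_w k ∈ GL₂(𝒪_w) × GL₁(𝒪_w)`).
[cite: Rogawski1990, §8.1 Props. 8.1.1–8.1.3 pp. 114–116; §4.3 (4.3.1) p. 43; §14.2 p. 232] [cite: HarishChandra1999AdmissibleDistributions, Thm. 3.1] -/
theorem centralGermShellKit_split
    (hGSP : ∀ {F : Type} [Field F] [ValuativeRel F] [TopologicalSpace F] [IsNonarchimedeanLocalField F]
      [MeasurableSpace (GL (Fin 2) F × GL (Fin 1) F)] [BorelSpace (GL (Fin 2) F × GL (Fin 1) F)]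
      [T2Space (GL (Fin 2) F × GL (Fin 1) F)] [LocallyCompactSpace (GL (Fin 2) F × GL (Fin 1) F)]
      [SecondCountableTopology (GL (Fin 2) F × GL (Fin 1) F)]
      [∀ γ : GL (Fin 2) F × GL (Fin 1) F,
        MeasurableSpace ((GL (Fin 2) F × GL (Fin 1) F) ⧸ Subgroup.centralizer ({γ} : Set (GL (Fin 2) F × GL (Fin 1) F)))]
      [∀ γ : GL (Fin 2) F × GL (Fin 1) F,
        BorelSpace ((GL (Fin 2) F × GL (Fin 1) F) ⧸ Subgroup.centralizer ({γ} : Set (GL (Fin 2) F × GL (Fin 1) F)))]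
      (ν : Measure (GL (Fin 2) F × GL (Fin 1) F)) [ν.IsHaarMeasure] [ν.IsMulRightInvariant] (z c : Fˣ),
      ∃ (γ : ℕ → GL (Fin 2) F × GL (Fin 1) F) (G : ℕ → ℂ) (lam lam' : ℂ),
        (∀ n, ((γ n).1 : Matrix (Fin 2) (Fin 2) F).trace ^ 2 - 4 * ((γ n).1 : Matrix (Fin 2) (Fin 2) F).det ≠ 0 ∧
          (((γ n).1 : Matrix (Fin 2) (Fin 2) F).charpoly).eval (((γ n).2 : Matrix (Fin 1) (Fin 1) F) 0 0) ≠ 0) ∧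
        (∀ n, ∃ ρ : Measure (Subgroup.centralizer ({γ n} : Set (GL (Fin 2) F × GL (Fin 1) F))),
          ρ.IsHaarMeasure ∧ ρ.IsInvInvariant ∧ ρ (compactCore (Subgroup.centralizer ({γ n} : Set (GL (Fin 2) F × GL (Fin 1) F)))) = 1) ∧
        Tendsto γ atTop (𝓝 (Units.map (Matrix.scalar (Fin 2) : F →+* Matrix (Fin 2) (Fin 2) F).toMonoidHom z,
          Units.map (Matrix.scalar (Fin 1) : F →+* Matrix (Fin 1) (Fin 1) F).toMonoidHom c)) ∧
        (Set.range G).Infinite ∧ lam ≠ 0 ∧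
        (∀ ψ : GL (Fin 2) F × GL (Fin 1) F → ℂ, IsLocSmooth ψ →
          ∃ a b : ℂ,
            (∀ᶠ n in atTop, ∀ (ρ : Measure (Subgroup.centralizer ({γ n} : Set (GL (Fin 2) F × GL (Fin 1) F))))
                [ρ.IsHaarMeasure] [ρ.IsInvInvariant],
                ρ (compactCore (Subgroup.centralizer ({γ n} : Set (GL (Fin 2) F × GL (Fin 1) F)))) = 1 →
                orbitalIntegral (γ n) ψ
                  (quotientMeasure (Subgroup.centralizer ({γ n} : Set (GL (Fin 2) F × GL (Fin 1) F))) ρ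
                    (isClosed_coe_centralizer_singleton (γ n)) ν) = a + b * G n) ∧
            ψ (Units.map (Matrix.scalar (Fin 2) : F →+* Matrix (Fin 2) (Fin 2) F).toMonoidHom z,
                Units.map (Matrix.scalar (Fin 1) : F →+* Matrix (Fin 1) (Fin 1) F).toMonoidHom c) = lam * a + lam' * b) ∧
        (∃ (ψ₁ ψ₂ : GL (Fin 2) F × GL (Fin 1) F → ℂ) (a₁ b₁ a₂ b₂ : ℂ), IsLocSmooth ψ₁ ∧ IsLocSmooth ψ₂ ∧
          (∀ᶠ n in atTop, ∀ (ρ : Measure (Subgroup.centralizer ({γ n} : Set (GL (Fin 2) F × GL (Fin 1) F))))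
              [ρ.IsHaarMeasure] [ρ.IsInvInvariant],
              ρ (compactCore (Subgroup.centralizer ({γ n} : Set (GL (Fin 2) F × GL (Fin 1) F)))) = 1 →
              orbitalIntegral (γ n) ψ₁
                (quotientMeasure (Subgroup.centralizer ({γ n} : Set (GL (Fin 2) F × GL (Fin 1) F))) ρ
                  (isClosed_coe_centralizer_singleton (γ n)) ν) = a₁ + b₁ * G n) ∧
          (∀ᶠ n in atTop, ∀ (ρ : Measure (Subgroup.centralizer ({γ n} : Set (GL (Fin 2) F × GL (Fin 1) F))))
              [ρ.IsHaarMeasure] [ρ.IsInvInvariant],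
              ρ (compactCore (Subgroup.centralizer ({γ n} : Set (GL (Fin 2) F × GL (Fin 1) F)))) = 1 →
              orbitalIntegral (γ n) ψ₂
                (quotientMeasure (Subgroup.centralizer ({γ n} : Set (GL (Fin 2) F × GL (Fin 1) F))) ρ
                  (isClosed_coe_centralizer_singleton (γ n)) ν) = a₂ + b₂ * G n) ∧
          a₁ * b₂ - a₂ * b₁ ≠ 0) ∧
        (∃ (y : ℕ → GL (Fin 2) F × GL (Fin 1) F) (Y : GL (Fin 2) F × GL (Fin 1) F),
          (∀ n, ∃ g : GL (Fin 2) F × GL (Fin 1) F, y n = g * γ n * g⁻¹) ∧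
          (Y.1 : Matrix (Fin 2) (Fin 2) F) = !![(z : F), 0; z, z] ∧
          Y.2 = Units.map (Matrix.scalar (Fin 1) : F →+* Matrix (Fin 1) (Fin 1) F).toMonoidHom c ∧
          Tendsto y atTop (𝓝 Y) ∧
          (∀ ψ : GL (Fin 2) F × GL (Fin 1) F → ℂ, IsLocSmooth ψ →
            (∀ n, ∃ cst : ℂ, cst ≠ 0 ∧ ∀ g : GL (Fin 2) F × GL (Fin 1) F, ∃ t : ℝ, 0 ≤ t ∧ ψ (g * γ n * g⁻¹) = cst * t) →
            (∃ N, ∀ n, N ≤ n → ∀ k ∈ (glInt 2 F).prod (glInt 1 F), ψ (k * y n * k⁻¹) ≠ 0) →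
            ∀ᶠ n in atTop, ∃ r : ℂ, r ≠ 0 ∧ ∀ (ρ : Measure (Subgroup.centralizer ({γ n} : Set (GL (Fin 2) F × GL (Fin 1) F))))
                [ρ.IsHaarMeasure] [ρ.IsInvInvariant],
                ρ (compactCore (Subgroup.centralizer ({γ n} : Set (GL (Fin 2) F × GL (Fin 1) F)))) = 1 →
                orbitalIntegral (γ n) ψ
                  (quotientMeasure (Subgroup.centralizer ({γ n} : Set (GL (Fin 2) F × GL (Fin 1) F))) ρ
                    (isClosed_coe_centralizer_singleton (γ n)) ν) = r)))
    (L : Type) [Field L] [NumberField L] [IsCMField L] (v : HeightOneSpectrum (𝓞 ↥(maximalRealSubfield L)))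
    (w : UnitaryGroup.PlacesOver L v) (hw : IsCMField.complexConj L • w.1 ≠ w.1)
    [MeasurableSpace ((UnitaryGroup.cmDatum L 2 (Matrix.of fun i j : Fin 2 => if i.val + j.val + 1 = 2 then (1 : L) else 0)).Local v × (UnitaryGroup.cmDatum L 1 (Matrix.of fun i j : Fin 1 => if i.val + j.val + 1 = 1 then (1 : L) else 0)).Local v)] [BorelSpace ((UnitaryGroup.cmDatum L 2 (Matrix.of fun i j : Fin 2 => if i.val + j.val + 1 = 2 then (1 : L) else 0)).Local v × (UnitaryGroup.cmDatum L 1 (Matrix.of fun i j : Fin 1 => if i.val + j.val + 1 = 1 then (1 : L) else 0)).Local v)]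
    [∀ a : ((UnitaryGroup.cmDatum L 2 (Matrix.of fun i j : Fin 2 => if i.val + j.val + 1 = 2 then (1 : L) else 0)).Local v × (UnitaryGroup.cmDatum L 1 (Matrix.of fun i j : Fin 1 => if i.val + j.val + 1 = 1 then (1 : L) else 0)).Local v), MeasurableSpace (((UnitaryGroup.cmDatum L 2 (Matrix.of fun i j : Fin 2 => if i.val + j.val + 1 = 2 then (1 : L) else 0)).Local v × (UnitaryGroup.cmDatum L 1 (Matrix.of fun i j : Fin 1 => if i.val + j.val + 1 = 1 then (1 : L) else 0)).Local v) ⧸ Subgroup.centralizer ({a} : Set ((UnitaryGroup.cmDatum L 2 (Matrix.of fun i j : Fin 2 => if i.val + j.val + 1 = 2 then (1 : L) else 0)).Local v × (UnitaryGroup.cmDatum L 1 (Matrix.of fun i j : Fin 1 => if i.val + j.val + 1 = 1 then (1 : L) else 0)).Local v)))]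
    [∀ a : ((UnitaryGroup.cmDatum L 2 (Matrix.of fun i j : Fin 2 => if i.val + j.val + 1 = 2 then (1 : L) else 0)).Local v × (UnitaryGroup.cmDatum L 1 (Matrix.of fun i j : Fin 1 => if i.val + j.val + 1 = 1 then (1 : L) else 0)).Local v), BorelSpace (((UnitaryGroup.cmDatum L 2 (Matrix.of fun i j : Fin 2 => if i.val + j.val + 1 = 2 then (1 : L) else 0)).Local v × (UnitaryGroup.cmDatum L 1 (Matrix.of fun i j : Fin 1 => if i.val + j.val + 1 = 1 then (1 : L) else 0)).Local v) ⧸ Subgroup.centralizer ({a} : Set ((UnitaryGroup.cmDatum L 2 (Matrix.of fun i j : Fin 2 => if i.val + j.val + 1 = 2 then (1 : L) else 0)).Local v × (UnitaryGroup.cmDatum L 1 (Matrix.of fun i j : Fin 1 => if i.val + j.val + 1 = 1 then (1 : L) else 0)).Local v)))]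
    (νHv : Measure ((UnitaryGroup.cmDatum L 2 (Matrix.of fun i j : Fin 2 => if i.val + j.val + 1 = 2 then (1 : L) else 0)).Local v × (UnitaryGroup.cmDatum L 1 (Matrix.of fun i j : Fin 1 => if i.val + j.val + 1 = 1 then (1 : L) else 0)).Local v)) [νHv.IsHaarMeasure] [νHv.IsMulRightInvariant]
    (mHv : OrbitalMeasureFamily ((UnitaryGroup.cmDatum L 2 (Matrix.of fun i j : Fin 2 => if i.val + j.val + 1 = 2 then (1 : L) else 0)).Local v × (UnitaryGroup.cmDatum L 1 (Matrix.of fun i j : Fin 1 => if i.val + j.val + 1 = 1 then (1 : L) else 0)).Local v)) (hcanH : mHv.IsCanonical (IsLocalGRegular L v) νHv)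
    (γH : (UnitaryGroup.cmDatum L 2 (Matrix.of fun i j : Fin 2 => if i.val + j.val + 1 = 2 then (1 : L) else 0)).Rational × (UnitaryGroup.cmDatum L 1 (Matrix.of fun i j : Fin 1 => if i.val + j.val + 1 = 1 then (1 : L) else 0)).Rational) (e₁ : L)
    (hγH₁ : (((γH.1 : unitaryGroup (cmConjRingHom L) (Matrix.of fun i j : Fin 2 => if i.val + j.val + 1 = 2 then (1 : L) else 0)).val : GL (Fin 2) L) : Matrix (Fin 2) (Fin 2) L) = e₁ • (1 : Matrix (Fin 2) (Fin 2) L)) :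
    ∃ (γ : ℕ → ((UnitaryGroup.cmDatum L 2 (Matrix.of fun i j : Fin 2 => if i.val + j.val + 1 = 2 then (1 : L) else 0)).Local v × (UnitaryGroup.cmDatum L 1 (Matrix.of fun i j : Fin 1 => if i.val + j.val + 1 = 1 then (1 : L) else 0)).Local v)) (G : ℕ → ℂ) (lam lam' : ℂ),
      (∀ n, IsLocalGRegular L v (γ n)) ∧
      Tendsto γ atTop (𝓝 (((UnitaryGroup.cmDatum L 2 (Matrix.of fun i j : Fin 2 => if i.val + j.val + 1 = 2 then (1 : L) else 0)).toLocal v ((UnitaryGroup.cmDatum L 2 (Matrix.of fun i j : Fin 2 => if i.val + j.val + 1 = 2 then (1 : L) else 0)).toAdelic γH.1)),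
          ((UnitaryGroup.cmDatum L 1 (Matrix.of fun i j : Fin 1 => if i.val + j.val + 1 = 1 then (1 : L) else 0)).toLocal v ((UnitaryGroup.cmDatum L 1 (Matrix.of fun i j : Fin 1 => if i.val + j.val + 1 = 1 then (1 : L) else 0)).toAdelic γH.2)))) ∧
      (Set.range G).Infinite ∧ lam ≠ 0 ∧
      (∀ φ : ((UnitaryGroup.cmDatum L 2 (Matrix.of fun i j : Fin 2 => if i.val + j.val + 1 = 2 then (1 : L) else 0)).Local v × (UnitaryGroup.cmDatum L 1 (Matrix.of fun i j : Fin 1 => if i.val + j.val + 1 = 1 then (1 : L) else 0)).Local v) → ℂ, IsLocSmooth φ →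
        ∃ a b : ℂ, (∀ᶠ n in atTop, stableOrbitalIntegralRel (IsLocalStablyConjH L v) mHv φ (γ n) = a + b * G n) ∧
          φ (((UnitaryGroup.cmDatum L 2 (Matrix.of fun i j : Fin 2 => if i.val + j.val + 1 = 2 then (1 : L) else 0)).toLocal v ((UnitaryGroup.cmDatum L 2 (Matrix.of fun i j : Fin 2 => if i.val + j.val + 1 = 2 then (1 : L) else 0)).toAdelic γH.1)),
          ((UnitaryGroup.cmDatum L 1 (Matrix.of fun i j : Fin 1 => if i.val + j.val + 1 = 1 then (1 : L) else 0)).toLocal v ((UnitaryGroup.cmDatum L 1 (Matrix.of fun i j : Fin 1 => if i.val + j.val + 1 = 1 then (1 : L) else 0)).toAdelic γH.2))) = lam * a + lam' * b) ∧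
      (∃ (y : ℕ → ((UnitaryGroup.cmDatum L 2 (Matrix.of fun i j : Fin 2 => if i.val + j.val + 1 = 2 then (1 : L) else 0)).Local v × (UnitaryGroup.cmDatum L 1 (Matrix.of fun i j : Fin 1 => if i.val + j.val + 1 = 1 then (1 : L) else 0)).Local v)) (Y : ((UnitaryGroup.cmDatum L 2 (Matrix.of fun i j : Fin 2 => if i.val + j.val + 1 = 2 then (1 : L) else 0)).Local v × (UnitaryGroup.cmDatum L 1 (Matrix.of fun i j : Fin 1 => if i.val + j.val + 1 = 1 then (1 : L) else 0)).Local v)),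
        (∀ n, ∃ g : ((UnitaryGroup.cmDatum L 2 (Matrix.of fun i j : Fin 2 => if i.val + j.val + 1 = 2 then (1 : L) else 0)).Local v × (UnitaryGroup.cmDatum L 1 (Matrix.of fun i j : Fin 1 => if i.val + j.val + 1 = 1 then (1 : L) else 0)).Local v), y n = g * γ n * g⁻¹) ∧
        ((UnitaryGroup.cmSplitEquivTwo L v w hw Y.1 : GL (Fin 2) (w.1.adicCompletion L)) : Matrix (Fin 2) (Fin 2) (w.1.adicCompletion L)) =
          !![algebraMap L (w.1.adicCompletion L) e₁, 0; algebraMap L (w.1.adicCompletion L) e₁, algebraMap L (w.1.adicCompletion L) e₁] ∧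
        UnitaryGroup.cmSplitEquivOne L v w hw Y.2 = UnitaryGroup.cmSplitEquivOne L v w hw ((UnitaryGroup.cmDatum L 1 (Matrix.of fun i j : Fin 1 => if i.val + j.val + 1 = 1 then (1 : L) else 0)).toLocal v ((UnitaryGroup.cmDatum L 1 (Matrix.of fun i j : Fin 1 => if i.val + j.val + 1 = 1 then (1 : L) else 0)).toAdelic γH.2)) ∧
        Tendsto y atTop (𝓝 Y) ∧
        (∀ φ : ((UnitaryGroup.cmDatum L 2 (Matrix.of fun i j : Fin 2 => if i.val + j.val + 1 = 2 then (1 : L) else 0)).Local v × (UnitaryGroup.cmDatum L 1 (Matrix.of fun i j : Fin 1 => if i.val + j.val + 1 = 1 then (1 : L) else 0)).Local v) → ℂ, IsLocSmooth φ →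
          (∀ n, ∃ cst : ℂ, cst ≠ 0 ∧ ∀ g : ((UnitaryGroup.cmDatum L 2 (Matrix.of fun i j : Fin 2 => if i.val + j.val + 1 = 2 then (1 : L) else 0)).Local v × (UnitaryGroup.cmDatum L 1 (Matrix.of fun i j : Fin 1 => if i.val + j.val + 1 = 1 then (1 : L) else 0)).Local v), ∃ t : ℝ, 0 ≤ t ∧ φ (g * γ n * g⁻¹) = cst * t) →
          (∃ N, ∀ n, N ≤ n → ∀ k : ((UnitaryGroup.cmDatum L 2 (Matrix.of fun i j : Fin 2 => if i.val + j.val + 1 = 2 then (1 : L) else 0)).Local v × (UnitaryGroup.cmDatum L 1 (Matrix.of fun i j : Fin 1 => if i.val + j.val + 1 = 1 then (1 : L) else 0)).Local v),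
            ((UnitaryGroup.cmSplitEquivTwo L v w hw k.1, UnitaryGroup.cmSplitEquivOne L v w hw k.2) :
                GL (Fin 2) (w.1.adicCompletion L) × GL (Fin 1) (w.1.adicCompletion L)) ∈
              (glInt 2 (w.1.adicCompletion L)).prod (glInt 1 (w.1.adicCompletion L)) → φ (k * y n * k⁻¹) ≠ 0) →
          ∀ᶠ n in atTop, stableOrbitalIntegralRel (IsLocalStablyConjH L v) mHv φ (γ n) ≠ 0)) := by
  classical
  -- (0) the local field `F = L_w`, the target group `P = GL₂(F) × GL₁(F)` and its structures (★ T0-loc ∕ ★ F-C2)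
  haveI : LocallyCompactSpace (GL (Fin 2) (w.1.adicCompletion L)) := UnitaryGroup.locallyCompactSpace_gl_adicCompletion L 2 w.1
  haveI : LocallyCompactSpace (GL (Fin 1) (w.1.adicCompletion L)) := UnitaryGroup.locallyCompactSpace_gl_adicCompletion L 1 w.1
  haveI : SecondCountableTopology (GL (Fin 2) (w.1.adicCompletion L)) := UnitaryGroup.secondCountableTopology_gl_adicCompletion L 2 w.1
  haveI : SecondCountableTopology (GL (Fin 1) (w.1.adicCompletion L)) := UnitaryGroup.secondCountableTopology_gl_adicCompletion L 1 w.1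
  letI : MeasurableSpace (GL (Fin 2) (w.1.adicCompletion L) × GL (Fin 1) (w.1.adicCompletion L)) := borel _
  haveI : BorelSpace (GL (Fin 2) (w.1.adicCompletion L) × GL (Fin 1) (w.1.adicCompletion L)) := ⟨rfl⟩
  letI : ∀ γ : GL (Fin 2) (w.1.adicCompletion L) × GL (Fin 1) (w.1.adicCompletion L),
      MeasurableSpace ((GL (Fin 2) (w.1.adicCompletion L) × GL (Fin 1) (w.1.adicCompletion L)) ⧸
        Subgroup.centralizer ({γ} : Set (GL (Fin 2) (w.1.adicCompletion L) × GL (Fin 1) (w.1.adicCompletion L)))) := fun _ => borel _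
  haveI : ∀ γ : GL (Fin 2) (w.1.adicCompletion L) × GL (Fin 1) (w.1.adicCompletion L),
      BorelSpace ((GL (Fin 2) (w.1.adicCompletion L) × GL (Fin 1) (w.1.adicCompletion L)) ⧸
        Subgroup.centralizer ({γ} : Set (GL (Fin 2) (w.1.adicCompletion L) × GL (Fin 1) (w.1.adicCompletion L)))) := fun _ => ⟨rfl⟩
  -- the frame `j = (j₂, j₁) : H_v ≃ₜ* P`
  let jj : ((UnitaryGroup.cmDatum L 2 (Matrix.of fun i j : Fin 2 => if i.val + j.val + 1 = 2 then (1 : L) else 0)).Local v × (UnitaryGroup.cmDatum L 1 (Matrix.of fun i j : Fin 1 => if i.val + j.val + 1 = 1 then (1 : L) else 0)).Local v) ≃ₜ* (GL (Fin 2) (w.1.adicCompletion L) × GL (Fin 1) (w.1.adicCompletion L)) :=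
    { toMulEquiv := MulEquiv.prodCongr (UnitaryGroup.cmSplitEquivTwo L v w hw).toMulEquiv (UnitaryGroup.cmSplitEquivOne L v w hw).toMulEquiv
      continuous_toFun := (UnitaryGroup.cmSplitEquivTwo L v w hw).continuous.prodMap (UnitaryGroup.cmSplitEquivOne L v w hw).continuous
      continuous_invFun :=
        (UnitaryGroup.cmSplitEquivTwo L v w hw).symm.continuous.prodMap (UnitaryGroup.cmSplitEquivOne L v w hw).symm.continuous }
  have hjj : ∀ x, jj x = (UnitaryGroup.cmSplitEquivTwo L v w hw x.1, UnitaryGroup.cmSplitEquivOne L v w hw x.2) := fun _ => rfl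
  have hjjs : ∀ p, jj.symm p = ((UnitaryGroup.cmSplitEquivTwo L v w hw).symm p.1, (UnitaryGroup.cmSplitEquivOne L v w hw).symm p.2) :=
    fun _ => rfl
  -- (1) `G`-regularity of `j⁻¹ p` under the two guards (★ p855356)
  have hreg : ∀ (p : GL (Fin 2) (w.1.adicCompletion L) × GL (Fin 1) (w.1.adicCompletion L)),
      (p.1 : Matrix (Fin 2) (Fin 2) (w.1.adicCompletion L)).trace ^ 2 - 4 * (p.1 : Matrix (Fin 2) (Fin 2) (w.1.adicCompletion L)).det ≠ 0 →
      ((p.1 : Matrix (Fin 2) (Fin 2) (w.1.adicCompletion L)).charpoly).eval ((p.2 : Matrix (Fin 1) (Fin 1) (w.1.adicCompletion L)) 0 0) ≠ 0 →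
      IsLocalGRegular L v (jj.symm p) := by
    intro p hd he
    have h1 : UnitaryGroup.cmSplitEquivTwo L v w hw (jj.symm p).1 = p.1 := by
      rw [hjjs]; exact (UnitaryGroup.cmSplitEquivTwo L v w hw).apply_symm_apply p.1
    have h2 : UnitaryGroup.cmSplitEquivOne L v w hw (jj.symm p).2 = p.2 := by
      rw [hjjs]; exact (UnitaryGroup.cmSplitEquivOne L v w hw).apply_symm_apply p.2
    refine K2E3CentralTransferVanishingSplit.isLocalGRegular_of_cmSplitEquiv L v (jj.symm p) w hw ?_ ?_
    · rw [h1]; exact hd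
    · rw [h1, h2]; exact he
  -- (2) the transported Haar measure `ν := j_* νHv`
  haveI : IsHaarMeasure (Measure.map jj νHv) := jj.isHaarMeasure_map νHv
  haveI : (Measure.map jj νHv).IsMulRightInvariant :=
    isMulRightInvariant_map_mulEquiv_of_isMulRightInvariant jj.toMulEquiv jj.continuous.measurable νHv
  -- (3) the centre on the `P` side: `j (γ_H)_v = (e₁·1₂, c)`
  haveI : CharZero (w.1.adicCompletion L) := charZero_of_injective_algebraMap (algebraMap L (w.1.adicCompletion L)).injective
  have he₁ : e₁ ≠ 0 := by
    intro h0
    have hu := Matrix.isUnits_det_units ((γH.1 : unitaryGroup (cmConjRingHom L) (Matrix.of fun i j : Fin 2 => if i.val + j.val + 1 = 2 then (1 : L) else 0)).val)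
    rw [hγH₁, h0, zero_smul, Matrix.det_zero] at hu
    exact not_isUnit_zero hu
  set z : (w.1.adicCompletion L)ˣ := Units.mk0 (algebraMap L (w.1.adicCompletion L) e₁)
    ((map_ne_zero_iff _ (algebraMap L (w.1.adicCompletion L)).injective).2 he₁) with hz
  set c : (w.1.adicCompletion L)ˣ := Matrix.GeneralLinearGroup.det (UnitaryGroup.cmSplitEquivOne L v w hw ((UnitaryGroup.cmDatum L 1 (Matrix.of fun i j : Fin 1 => if i.val + j.val + 1 = 1 then (1 : L) else 0)).toLocal v ((UnitaryGroup.cmDatum L 1 (Matrix.of fun i j : Fin 1 => if i.val + j.val + 1 = 1 then (1 : L) else 0)).toAdelic γH.2))) with hc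
  have hjγ : jj (((UnitaryGroup.cmDatum L 2 (Matrix.of fun i j : Fin 2 => if i.val + j.val + 1 = 2 then (1 : L) else 0)).toLocal v ((UnitaryGroup.cmDatum L 2 (Matrix.of fun i j : Fin 2 => if i.val + j.val + 1 = 2 then (1 : L) else 0)).toAdelic γH.1)),
          ((UnitaryGroup.cmDatum L 1 (Matrix.of fun i j : Fin 1 => if i.val + j.val + 1 = 1 then (1 : L) else 0)).toLocal v ((UnitaryGroup.cmDatum L 1 (Matrix.of fun i j : Fin 1 => if i.val + j.val + 1 = 1 then (1 : L) else 0)).toAdelic γH.2))) =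
      (Units.map (Matrix.scalar (Fin 2) : w.1.adicCompletion L →+* Matrix (Fin 2) (Fin 2) (w.1.adicCompletion L)).toMonoidHom z,
        Units.map (Matrix.scalar (Fin 1) : w.1.adicCompletion L →+* Matrix (Fin 1) (Fin 1) (w.1.adicCompletion L)).toMonoidHom c) := by
    rw [hjj]
    refine Prod.ext (Units.ext ?_) (Units.ext ?_)
    · change ((((UnitaryGroup.cmDatum L 2 (Matrix.of fun i j : Fin 2 => if i.val + j.val + 1 = 2 then (1 : L) else 0)).toLocal v ((UnitaryGroup.cmDatum L 2 (Matrix.of fun i j : Fin 2 => if i.val + j.val + 1 = 2 then (1 : L) else 0)).toAdelic γH.1)).val :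
            GL (Fin 2) (UnitaryGroup.LocalRing L v)).val : Matrix (Fin 2) (Fin 2) (UnitaryGroup.LocalRing L v)).map
          (Pi.evalRingHom (fun w : UnitaryGroup.PlacesOver L v => w.1.adicCompletion L) w) =
        Matrix.scalar (Fin 2) (z : w.1.adicCompletion L)
      rw [K2E4ExplicitSplitConstantPhase.coe_fst_local_eq_smul_one L v γH hγH₁, Matrix.map_smul' _ _ _ (map_mul _),
        Matrix.map_one _ (map_zero _) (map_one _), hz, Units.val_mk0, Matrix.scalar_apply, ← Matrix.smul_one_eq_diagonal]
      rfl
    · ext i j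
      fin_cases i; fin_cases j
      rw [hc]
      simp [Matrix.scalar_apply, Matrix.GeneralLinearGroup.val_det_apply]
  have hjγs : jj.symm (Units.map (Matrix.scalar (Fin 2) : w.1.adicCompletion L →+* Matrix (Fin 2) (Fin 2) (w.1.adicCompletion L)).toMonoidHom z,
        Units.map (Matrix.scalar (Fin 1) : w.1.adicCompletion L →+* Matrix (Fin 1) (Fin 1) (w.1.adicCompletion L)).toMonoidHom c) = (((UnitaryGroup.cmDatum L 2 (Matrix.of fun i j : Fin 2 => if i.val + j.val + 1 = 2 then (1 : L) else 0)).toLocal v ((UnitaryGroup.cmDatum L 2 (Matrix.of fun i j : Fin 2 => if i.val + j.val + 1 = 2 then (1 : L) else 0)).toAdelic γH.1)),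
          ((UnitaryGroup.cmDatum L 1 (Matrix.of fun i j : Fin 1 => if i.val + j.val + 1 = 1 then (1 : L) else 0)).toLocal v ((UnitaryGroup.cmDatum L 1 (Matrix.of fun i j : Fin 1 => if i.val + j.val + 1 = 1 then (1 : L) else 0)).toAdelic γH.2))) := by
    rw [← hjγ, ContinuousMulEquiv.symm_apply_apply]
  -- (4) the letter (GS^P⁺) at `(F, ν, z, c) = (L_w, j_* νHv, e₁, c)`
  obtain ⟨γP, G, lam, lam', hguard, hρex, hlim, hG, hlam, hOI, -, y, Y, hyconj, hY1, hY2, hylim, hcrit⟩ := hGSP (Measure.map jj νHv) z c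
  -- the per-point transport, for a fixed `n`
  have htr : ∀ (n : ℕ) (ψ : GL (Fin 2) (w.1.adicCompletion L) × GL (Fin 1) (w.1.adicCompletion L) → ℂ) (r : ℂ),
      (∀ (ρ : Measure ↥(Subgroup.centralizer ({γP n} : Set (GL (Fin 2) (w.1.adicCompletion L) × GL (Fin 1) (w.1.adicCompletion L)))))
        [ρ.IsHaarMeasure] [ρ.IsInvInvariant],
        ρ (compactCore ↥(Subgroup.centralizer ({γP n} : Set (GL (Fin 2) (w.1.adicCompletion L) × GL (Fin 1) (w.1.adicCompletion L))))) = 1 →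
        orbitalIntegral (γP n) ψ (quotientMeasure (Subgroup.centralizer ({γP n} : Set (GL (Fin 2) (w.1.adicCompletion L) × GL (Fin 1) (w.1.adicCompletion L)))) ρ
          (isClosed_coe_centralizer_singleton (γP n)) (Measure.map jj νHv)) = r) →
      stableOrbitalIntegralRel (IsLocalStablyConjH L v) mHv (fun x => ψ (jj x)) (jj.symm (γP n)) = r :=
    fun n ψ r h => stableOrbitalIntegralRel_comp_eq_of_forall_canonical L v w hw νHv mHv hcanH jj (Measure.map jj νHv) rfl
      (jj.symm (γP n)) (hreg (γP n) (hguard n).1 (hguard n).2) (γP n) (jj.apply_symm_apply (γP n)) ψ r (hρex n) h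
  have hback : ∀ φ : ((UnitaryGroup.cmDatum L 2 (Matrix.of fun i j : Fin 2 => if i.val + j.val + 1 = 2 then (1 : L) else 0)).Local v × (UnitaryGroup.cmDatum L 1 (Matrix.of fun i j : Fin 1 => if i.val + j.val + 1 = 1 then (1 : L) else 0)).Local v) → ℂ,
      (fun x => (fun p : GL (Fin 2) (w.1.adicCompletion L) × GL (Fin 1) (w.1.adicCompletion L) => φ (jj.symm p)) (jj x)) = φ := fun φ => by
    funext x
    exact congrArg φ (jj.symm_apply_apply x)
  refine ⟨fun n => jj.symm (γP n), G, lam, lam', fun n => hreg (γP n) (hguard n).1 (hguard n).2, ?_, hG, hlam, ?_, ?_⟩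
  · -- the ray tends to `(γ_H)_v = j⁻¹ (e₁·1₂, c)`
    rw [← hjγs]
    exact (jj.symm.continuous.tendsto _).comp hlim
  · -- the germ relation and the value identity for every smooth `φ` on `H_v`
    intro φ hφ
    have hψ : IsLocSmooth (fun p : GL (Fin 2) (w.1.adicCompletion L) × GL (Fin 1) (w.1.adicCompletion L) => φ (jj.symm p)) :=
      hφ.comp_homeomorph' jj.symm.toHomeomorph
    obtain ⟨a, b, hev, hval⟩ := hOI _ hψ
    refine ⟨a, b, ?_, ?_⟩
    · filter_upwards [hev] with n hn
      have h := htr n _ (a + b * G n) hn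
      rwa [hback] at h
    · rw [← hval, ← hjγ, ContinuousMulEquiv.symm_apply_apply]
  · -- THE SHELL KIT
    refine ⟨fun n => jj.symm (y n), jj.symm Y, fun n => ?_, ?_, ?_, (jj.symm.continuous.tendsto _).comp hylim, ?_⟩
    · obtain ⟨g, hg⟩ := hyconj n
      refine ⟨jj.symm g, ?_⟩
      show jj.symm (y n) = jj.symm g * jj.symm (γP n) * (jj.symm g)⁻¹
      rw [hg, map_mul, map_mul, map_inv]
    · have h1 : UnitaryGroup.cmSplitEquivTwo L v w hw (jj.symm Y).1 = Y.1 := by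
        rw [hjjs]; exact (UnitaryGroup.cmSplitEquivTwo L v w hw).apply_symm_apply Y.1
      rw [h1, hY1, hz, Units.val_mk0]
    · have h2 : UnitaryGroup.cmSplitEquivOne L v w hw (jj.symm Y).2 = Y.2 := by
        rw [hjjs]; exact (UnitaryGroup.cmSplitEquivOne L v w hw).apply_symm_apply Y.2
      have h3 := congrArg Prod.snd hjγ
      rw [hjj] at h3
      rw [h2, hY2]
      exact h3.symm
    · intro φ hφ hcoh hpos
      have hψ : IsLocSmooth (fun p : GL (Fin 2) (w.1.adicCompletion L) × GL (Fin 1) (w.1.adicCompletion L) => φ (jj.symm p)) :=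
        hφ.comp_homeomorph' jj.symm.toHomeomorph
      have hcoh' : ∀ n, ∃ cst : ℂ, cst ≠ 0 ∧ ∀ g : GL (Fin 2) (w.1.adicCompletion L) × GL (Fin 1) (w.1.adicCompletion L), ∃ t : ℝ, 0 ≤ t ∧
          (fun p : GL (Fin 2) (w.1.adicCompletion L) × GL (Fin 1) (w.1.adicCompletion L) => φ (jj.symm p)) (g * γP n * g⁻¹) = cst * t := fun n => by
        obtain ⟨cst, hc0, h⟩ := hcoh n
        refine ⟨cst, hc0, fun g => ?_⟩
        obtain ⟨t, ht, hh⟩ := h (jj.symm g)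
        refine ⟨t, ht, ?_⟩
        simp only [map_mul, map_inv]
        exact hh
      have hpos' : ∃ N, ∀ n, N ≤ n → ∀ k ∈ (glInt 2 (w.1.adicCompletion L)).prod (glInt 1 (w.1.adicCompletion L)),
          (fun p : GL (Fin 2) (w.1.adicCompletion L) × GL (Fin 1) (w.1.adicCompletion L) => φ (jj.symm p)) (k * y n * k⁻¹) ≠ 0 := by
        obtain ⟨N, hN⟩ := hpos
        refine ⟨N, fun n hn k hk => ?_⟩
        have hk' : ((UnitaryGroup.cmSplitEquivTwo L v w hw (jj.symm k).1, UnitaryGroup.cmSplitEquivOne L v w hw (jj.symm k).2) :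
            GL (Fin 2) (w.1.adicCompletion L) × GL (Fin 1) (w.1.adicCompletion L)) ∈
            (glInt 2 (w.1.adicCompletion L)).prod (glInt 1 (w.1.adicCompletion L)) := by
          rw [← hjj, ContinuousMulEquiv.apply_symm_apply]; exact hk
        have := hN n hn (jj.symm k) hk'
        simp only [map_mul, map_inv]
        exact this
      filter_upwards [hcrit _ hψ hcoh' hpos'] with n hn
      obtain ⟨r, hr0, hr⟩ := hn
      have h := htr n _ r hr
      rw [hback] at h
      rw [h]
      exact hr0

end Summit.HodgeConjecture.HodgeConjecture.Cruxes.H413.K2E3CentralGermShellKitSplit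

end
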